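import Summits.Ventures.Crystal3D.Theorems.StickyWulffConstantPolycrystalWulffBoundInductionRows
import Summits.Ventures.Crystal3D.Theorems.StickyWulffConstantPolycrystalWulffBoundClassRows

/-!
# `PolycrystalWulffBound`, line `PolyDensity`: recolouring / deletion rows at CLASS level (aggregated step, part 2)

Route `StickyWulffConstant` of the venture `Summits/Ventures/Crystal3D`, crux `PolycrystalWulffBound`
(item `stmt-Ventures-19482`), second prover lane (poly-p2, gen 4).  The grain-level rows `rec_row_of_IH` /
`del_row_of_IH` rewritten in the CLASS variables of `aggStaticRows` / `def AggCert27_8`: for a set `𝒮` of classes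
(labelling `cls : Fin n → β`) recoloured into the class of `ℓ₀` (resp. deleted),
`κV ≤ En + (√5−√3)·Σ_{i∈𝒮} Y i − Σ_{i,j ∈ 𝒮 ∪ {cls ℓ₀}, i≠j} Acl i j / 2` and
`κ(V − Σ_{i∈𝒮} v i) ≤ En − Σ_{i∈𝒮} Fr i + (√5−1)·Σ_{i∉𝒮} Σ_{j∈𝒮} Acl i j − Σ_{i,j∈𝒮, i≠j} Acl i j / 2`
(`Fr i` the class free energy with the grains' own Wulff bodies).  First the pure bookkeeping identities
(`Theorems` namespace): double sums fibrewise over classes, the class-pair form of restricted cross-class sums,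
sums over the grains of a set of classes.
WHAT THIS IS NOT: the instantiation at the three largest classes (aggregated step, part 3); F-C1 not moved.
-/

noncomputable section

open scoped BigOperators InnerProductSpace ENNReal
open MeasureTheory Filter

namespace Summit.Ventures.Crystal3D.Theorems

variable {n : ℕ} {β : Type} [Fintype β] [DecidableEq β]

/-- Double sums over grains, fibrewise over classes. -/
theorem sum_sum_fiberwise_classes (cls : Fin n → β) (φ : Fin n → Fin n → ℝ) :
    (∑ f, ∑ g, φ f g) = ∑ i, ∑ j, ∑ f ∈ Finset.univ.filter (fun f => cls f = i),
      ∑ g ∈ Finset.univ.filter (fun g => cls g = j), φ f g := by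
  classical
  have hfibg : ∀ (ψ : Fin n → ℝ), (∑ g, ψ g) = ∑ j, ∑ g ∈ Finset.univ.filter (fun g => cls g = j), ψ g :=
    fun ψ => (Finset.sum_fiberwise_of_maps_to (s := Finset.univ) (t := Finset.univ) (g := cls)
      (fun _ _ => Finset.mem_univ _) ψ).symm
  rw [hfibg (fun f => ∑ g, φ f g)]
  refine Finset.sum_congr rfl fun i _ => ?_
  rw [show (∑ f ∈ Finset.univ.filter (fun f => cls f = i), ∑ g, φ f g) =
      ∑ f ∈ Finset.univ.filter (fun f => cls f = i), ∑ j, ∑ g ∈ Finset.univ.filter (fun g => cls g = j), φ f g from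
    Finset.sum_congr rfl fun f _ => hfibg (φ f), Finset.sum_comm]

/-- Restricted cross-class sums in class-pair form: for a predicate `P` on classes,
`Σ_f Σ_g [f ≠ g, P(cls f), P(cls g), cls f ≠ cls g] w/2 = Σ_i Σ_j [P i, P j, i ≠ j] Acl i j / 2`. -/
theorem classCross_sum (cls : Fin n → β) (w : Fin n → Fin n → ℝ) (P : β → Prop) [DecidablePred P] :
    (∑ f, ∑ g, (if f ≠ g ∧ P (cls f) ∧ P (cls g) ∧ cls f ≠ cls g then w f g / 2 else 0)) =
      ∑ i, ∑ j, (if (P i ∧ P j) ∧ i ≠ j then (∑ f ∈ Finset.univ.filter (fun f => cls f = i),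
        ∑ g ∈ Finset.univ.filter (fun g => cls g = j), w f g) / 2 else 0) := by
  classical
  rw [sum_sum_fiberwise_classes cls]
  refine Finset.sum_congr rfl fun i _ => Finset.sum_congr rfl fun j _ => ?_
  by_cases hP : (P i ∧ P j) ∧ i ≠ j
  · rw [if_pos hP, Finset.sum_div]
    refine Finset.sum_congr rfl fun f hf => ?_
    rw [Finset.sum_div]
    refine Finset.sum_congr rfl fun g hg => ?_
    have hcf := (Finset.mem_filter.1 hf).2; have hcg := (Finset.mem_filter.1 hg).2
    have hfg : f ≠ g := fun h => hP.2 (by rw [← hcf, ← hcg, h])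
    rw [if_pos ⟨hfg, by rw [hcf]; exact hP.1.1, by rw [hcg]; exact hP.1.2, by rw [hcf, hcg]; exact hP.2⟩]
  · rw [if_neg hP]
    refine Finset.sum_eq_zero fun f hf => Finset.sum_eq_zero fun g hg => ?_
    have hcf := (Finset.mem_filter.1 hf).2; have hcg := (Finset.mem_filter.1 hg).2
    rw [if_neg]; rintro ⟨-, h1, h2, h3⟩
    exact hP ⟨⟨by rw [← hcf]; exact h1, by rw [← hcg]; exact h2⟩, by rw [← hcf, ← hcg]; exact h3⟩

omit [Fintype β] in
/-- Sums over the grains of a set of classes, fibrewise. -/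
theorem classSet_sum (cls : Fin n → β) (ψ : Fin n → ℝ) (𝒮 : Finset β) :
    (∑ f ∈ Finset.univ.filter (fun f => cls f ∈ 𝒮), ψ f) =
      ∑ i ∈ 𝒮, ∑ f ∈ Finset.univ.filter (fun f => cls f = i), ψ f := by
  classical
  rw [← Finset.sum_fiberwise_of_maps_to (g := cls) (t := 𝒮) (fun f hf => (Finset.mem_filter.1 hf).2)]
  refine Finset.sum_congr rfl fun i hi => Finset.sum_congr ?_ fun f _ => rfl
  ext f; simp only [Finset.mem_filter, Finset.mem_univ, true_and]
  exact ⟨fun h => h.2, fun h => ⟨h ▸ hi, h⟩⟩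

/-- Mixed sums `Σ_f Σ_g [f ∉ S, g ∈ S] w` for the grain set of a set of classes. -/
theorem classSet_cut_sum (cls : Fin n → β) (w : Fin n → Fin n → ℝ) (𝒮 : Finset β) :
    (∑ f, ∑ g, (if f ∉ Finset.univ.filter (fun f => cls f ∈ 𝒮) ∧ g ∈ Finset.univ.filter (fun f => cls f ∈ 𝒮)
      then w f g else 0)) =
      ∑ i ∈ Finset.univ \ 𝒮, ∑ j ∈ 𝒮, ∑ f ∈ Finset.univ.filter (fun f => cls f = i),
        ∑ g ∈ Finset.univ.filter (fun g => cls g = j), w f g := by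
  classical
  rw [sum_sum_fiberwise_classes cls]
  rw [← Finset.sum_sdiff (Finset.subset_univ 𝒮)]
  have hzero : ∑ i ∈ 𝒮, ∑ j, ∑ f ∈ Finset.univ.filter (fun f => cls f = i), ∑ g ∈ Finset.univ.filter (fun g => cls g = j),
      (if f ∉ Finset.univ.filter (fun f => cls f ∈ 𝒮) ∧ g ∈ Finset.univ.filter (fun f => cls f ∈ 𝒮) then w f g else 0) = 0 := by
    refine Finset.sum_eq_zero fun i hi => Finset.sum_eq_zero fun j _ => Finset.sum_eq_zero fun f hf =>
      Finset.sum_eq_zero fun g _ => ?_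
    rw [if_neg]; rintro ⟨h1, -⟩
    exact h1 (Finset.mem_filter.2 ⟨Finset.mem_univ _, (Finset.mem_filter.1 hf).2 ▸ hi⟩)
  rw [hzero, add_zero]
  refine Finset.sum_congr rfl fun i hi => ?_
  rw [← Finset.sum_sdiff (Finset.subset_univ 𝒮)]
  have hzero' : ∑ j ∈ Finset.univ \ 𝒮, ∑ f ∈ Finset.univ.filter (fun f => cls f = i), ∑ g ∈ Finset.univ.filter (fun g => cls g = j),
      (if f ∉ Finset.univ.filter (fun f => cls f ∈ 𝒮) ∧ g ∈ Finset.univ.filter (fun f => cls f ∈ 𝒮) then w f g else 0) = 0 := by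
    refine Finset.sum_eq_zero fun j hj => Finset.sum_eq_zero fun f _ => Finset.sum_eq_zero fun g hg => ?_
    rw [if_neg]; rintro ⟨-, h2⟩
    exact (Finset.mem_sdiff.1 hj).2 ((Finset.mem_filter.1 hg).2 ▸ (Finset.mem_filter.1 h2).2)
  rw [hzero', zero_add]
  refine Finset.sum_congr rfl fun j hj => Finset.sum_congr rfl fun f hf => Finset.sum_congr rfl fun g hg => ?_
  rw [if_pos]
  refine ⟨fun h => (Finset.mem_sdiff.1 hi).2 ((Finset.mem_filter.1 hf).2 ▸ (Finset.mem_filter.1 h).2),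
    Finset.mem_filter.2 ⟨Finset.mem_univ _, (Finset.mem_filter.1 hg).2 ▸ hj⟩⟩

end Summit.Ventures.Crystal3D.Theorems

namespace Summit.Ventures.Crystal3D.Cruxes.PolycrystalWulffBound.PolyDensity

open Summit.Ventures.Crystal3D.Theorems

/-- **Recolouring row at class level.**  See the module docstring. -/
theorem rec_row_classes :
    let Λ : Set (EuclideanSpace ℝ (Fin 3)) := Literature.MathematicalPhysics.StatisticalMechanics.fccStacking 1 (Real.sqrt (2 / 3));
    let Brl : (ℤ → ℤ) → Set (EuclideanSpace ℝ (Fin 3)) := Literature.MathematicalPhysics.StatisticalMechanics.barlowStacking 1 (Real.sqrt (2 / 3));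
    let Ax : EuclideanSpace ℝ (Fin 3) → (EuclideanSpace ℝ (Fin 3) ≃ₗᵢ[ℝ] EuclideanSpace ℝ (Fin 3)) → (EuclideanSpace ℝ (Fin 3) ≃ₗᵢ[ℝ] EuclideanSpace ℝ (Fin 3)) → Prop := fun m A B => ∃ (L : EuclideanSpace ℝ (Fin 3) ≃ₗᵢ[ℝ] EuclideanSpace ℝ (Fin 3)) (s₁ s₂ : EuclideanSpace ℝ (Fin 3)) (σ σ' : ℤ → ℤ), Literature.MathematicalPhysics.StatisticalMechanics.IsHaggSeq σ ∧ Literature.MathematicalPhysics.StatisticalMechanics.IsHaggSeq σ' ∧ L (EuclideanSpace.single (2 : Fin 3) (1 : ℝ)) = m ∧ A '' Λ ⊆ (fun q => L q + s₁) '' Brl σ ∧ B '' Λ ⊆ (fun q => L q + s₂) '' Brl σ';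
    let CoAx : (EuclideanSpace ℝ (Fin 3) ≃ₗᵢ[ℝ] EuclideanSpace ℝ (Fin 3)) → (EuclideanSpace ℝ (Fin 3) ≃ₗᵢ[ℝ] EuclideanSpace ℝ (Fin 3)) → Prop := fun A B => ∃ m, Ax m A B;
    let Φ : EuclideanSpace ℝ (Fin 3) → ℝ := fun ν => Real.sqrt 2 / 4 * ∑ᶠ w ∈ {w ∈ Λ | ‖w‖ = 1}, |⟪w, ν⟫_ℝ|;
    let Per : Set (EuclideanSpace ℝ (Fin 3)) → Set (EuclideanSpace ℝ (Fin 3)) → ℝ := fun K S => (⨆ (ξ : EuclideanSpace ℝ (Fin 3) → EuclideanSpace ℝ (Fin 3)) (_ : ContDiff ℝ 1 ξ ∧ HasCompactSupport ξ ∧ ∀ z, ξ z ∈ K), ENNReal.ofReal (∫ z in S, Literature.MathematicalPhysics.StatisticalMechanics.fieldDivergence ξ z)).toReal;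
    let ι : Set (EuclideanSpace ℝ (Fin 3)) → Set (EuclideanSpace ℝ (Fin 3)) → Set (EuclideanSpace ℝ (Fin 3)) → ℝ := fun K S₁ S₂ => (Per K S₁ + Per K S₂ - Per K (S₁ ∪ S₂)) / 2;
    let W : (EuclideanSpace ℝ (Fin 3) ≃ₗᵢ[ℝ] EuclideanSpace ℝ (Fin 3)) → Set (EuclideanSpace ℝ (Fin 3)) := fun A => {y | ∀ ν : EuclideanSpace ℝ (Fin 3), ⟪y, ν⟫_ℝ ≤ Φ (A.symm ν)};
    let Dsc : EuclideanSpace ℝ (Fin 3) → Set (EuclideanSpace ℝ (Fin 3)) := fun m => {y | ‖y‖ ≤ 1 ∧ ⟪y, m⟫_ℝ = 0};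
    let Tex : (n : ℕ) → (Fin n → Set (EuclideanSpace ℝ (Fin 3))) → (Fin n → (EuclideanSpace ℝ (Fin 3) ≃ₗᵢ[ℝ] EuclideanSpace ℝ (Fin 3))) → (Fin n → Fin n → ℝ) → (Fin n → Fin n → EuclideanSpace ℝ (Fin 3)) → Prop := fun n G A c m => (∀ f : Fin n, Literature.MathematicalPhysics.StatisticalMechanics.HasFinitePerimeter (G f) ∧ volume (G f) < ⊤) ∧ (∀ f g, f ≠ g → Disjoint (G f) (G g)) ∧ (∀ f g, f ≠ g → 0 ≤ c f g) ∧ (∀ f g, f ≠ g → ¬ CoAx (A f) (A g) → m f g = 0 ∧ 1 ≤ c f g) ∧ (∀ f g, f ≠ g → CoAx (A f) (A g) → A f '' Λ ≠ A g '' Λ → Ax (m f g) (A f) (A g) ∧ 1 / 2 ≤ c f g);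
    let En : (n : ℕ) → (Fin n → Set (EuclideanSpace ℝ (Fin 3))) → (Fin n → (EuclideanSpace ℝ (Fin 3) ≃ₗᵢ[ℝ] EuclideanSpace ℝ (Fin 3))) → (Fin n → Fin n → ℝ) → (Fin n → Fin n → EuclideanSpace ℝ (Fin 3)) → ℝ := fun n G A c m => ∑ f : Fin n, Per (W (A f)) (G f) - ∑ f, ∑ g, (if f = g then 0 else ι (W (A f)) (G f) (G g)) + ∑ f, ∑ g, (if f = g then 0 else c f g / 2 * ι (Dsc (m f g)) (G f) (G g));
    let Vol : (n : ℕ) → (Fin n → Set (EuclideanSpace ℝ (Fin 3))) → ℝ := fun n G => (volume (⋃ f : Fin n, G f)).toReal;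
    let Poly : Set (EuclideanSpace ℝ (Fin 3)) → Prop := fun S => ∃ (k : ℕ) (H : Fin k → Finset ((EuclideanSpace ℝ (Fin 3)) × ℝ)), S = ⋃ i, ⋂ p ∈ H i, {x | ⟪p.1, x⟫_ℝ < p.2};
    let TF : (n : ℕ) → (Fin n → (EuclideanSpace ℝ (Fin 3) ≃ₗᵢ[ℝ] EuclideanSpace ℝ (Fin 3))) → Prop := fun n A => ∀ f g : Fin n, f ≠ g → CoAx (A f) (A g) → A f '' Λ = A g '' Λ;
    ∀ (n : ℕ) (G : Fin n → Set (EuclideanSpace ℝ (Fin 3))) (A : Fin n → (EuclideanSpace ℝ (Fin 3) ≃ₗᵢ[ℝ] EuclideanSpace ℝ (Fin 3))) (c : Fin n → Fin n → ℝ) (m : Fin n → Fin n → EuclideanSpace ℝ (Fin 3))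
      (β : Type) [Fintype β] [DecidableEq β] (cls : Fin n → β) (𝒮 : Finset β) (ℓ₀ : Fin n),
      Tex n G A c m → (∀ f, Poly (G f)) → TF n A →
      (∀ f g : Fin n, cls f = cls g ↔ A f '' Λ = A g '' Λ) → cls ℓ₀ ∉ 𝒮 → (∃ f, cls f ∈ 𝒮) →
      (∀ (G' : Fin n → Set (EuclideanSpace ℝ (Fin 3))) (A' : Fin n → (EuclideanSpace ℝ (Fin 3) ≃ₗᵢ[ℝ] EuclideanSpace ℝ (Fin 3)))
        (c' : Fin n → Fin n → ℝ) (m' : Fin n → Fin n → EuclideanSpace ℝ (Fin 3)),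
        Tex n G' A' c' m' → (∀ f, Poly (G' f)) → TF n A' →
        (Finset.univ.image fun f => A' f '' Λ).card < (Finset.univ.image fun f => A f '' Λ).card →
        6 * (2 : ℝ) ^ ((1 : ℝ) / 3) * (Real.sqrt 2 * Vol n G') ^ ((2 : ℝ) / 3) ≤ En n G' A' c' m') →
      6 * (2 : ℝ) ^ ((1 : ℝ) / 3) * (Real.sqrt 2 * Vol n G) ^ ((2 : ℝ) / 3) ≤ En n G A c m
        + (Real.sqrt 5 - Real.sqrt 3) * (∑ i ∈ 𝒮, (∑ f ∈ Finset.univ.filter (fun f => cls f = i), (Per (Metric.closedBall (0 : EuclideanSpace ℝ (Fin 3)) 1) (G f) - ∑ g, (if f = g then 0 else ι (Metric.closedBall (0 : EuclideanSpace ℝ (Fin 3)) 1) (G f) (G g)))))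
        - (∑ i, ∑ j, (if ((i ∈ insert (cls ℓ₀) 𝒮) ∧ (j ∈ insert (cls ℓ₀) 𝒮)) ∧ i ≠ j then (∑ f ∈ Finset.univ.filter (fun f => cls f = i), ∑ g ∈ Finset.univ.filter (fun g => cls g = j), (Per (Metric.closedBall (0 : EuclideanSpace ℝ (Fin 3)) 1) (G f) + Per (Metric.closedBall (0 : EuclideanSpace ℝ (Fin 3)) 1) (G g) - Per (Metric.closedBall (0 : EuclideanSpace ℝ (Fin 3)) 1) (G f ∪ G g)) / 2) / 2 else 0)) := by
  intro Λ Brl Ax CoAx Φ Per ι W Dsc Tex En Vol Poly TF n G A c m β _ _ cls 𝒮 ℓ₀ hTex hPoly hTF hcls hℓ₀ hne hIH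
  classical
  set S : Finset (Fin n) := Finset.univ.filter (fun f => cls f ∈ 𝒮) with hSdef
  have hS : ∀ f g : Fin n, cls f = cls g → f ∈ S → g ∈ S := by
    intro f g hfg hf; simp only [hSdef, Finset.mem_filter, Finset.mem_univ, true_and] at hf ⊢; rwa [← hfg]
  have hℓ₀S : ℓ₀ ∉ S := by simp only [hSdef, Finset.mem_filter, Finset.mem_univ, true_and]; exact hℓ₀
  have hneS : S.Nonempty := by
    obtain ⟨f, hf⟩ := hne; exact ⟨f, Finset.mem_filter.2 ⟨Finset.mem_univ _, hf⟩⟩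
  have h := rec_row_of_IH n G A c m β cls S ℓ₀ hTex hPoly hTF hcls hS hℓ₀S hneS hIH
  have hmem : ∀ f, (f ∈ S ∨ cls f = cls ℓ₀) ↔ cls f ∈ insert (cls ℓ₀) 𝒮 := by
    intro f; simp only [hSdef, Finset.mem_filter, Finset.mem_univ, true_and, Finset.mem_insert]; tauto
  have hY := classSet_sum cls (fun f => Per (Metric.closedBall (0 : EuclideanSpace ℝ (Fin 3)) 1) (G f) - ∑ g, (if f = g then 0 else ι (Metric.closedBall (0 : EuclideanSpace ℝ (Fin 3)) 1) (G f) (G g))) 𝒮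
  have hA := classCross_sum cls (fun f g => (Per (Metric.closedBall (0 : EuclideanSpace ℝ (Fin 3)) 1) (G f) + Per (Metric.closedBall (0 : EuclideanSpace ℝ (Fin 3)) 1) (G g) - Per (Metric.closedBall (0 : EuclideanSpace ℝ (Fin 3)) 1) (G f ∪ G g)) / 2) (fun i => i ∈ insert (cls ℓ₀) 𝒮)
  have hI : (∑ f, ∑ g, (if f ≠ g ∧ (f ∈ S ∨ cls f = cls ℓ₀) ∧ (g ∈ S ∨ cls g = cls ℓ₀) ∧ cls f ≠ cls g
      then ι (Metric.closedBall (0 : EuclideanSpace ℝ (Fin 3)) 1) (G f) (G g) / 2 else 0)) =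
      ∑ f, ∑ g, (if f ≠ g ∧ (cls f ∈ insert (cls ℓ₀) 𝒮) ∧ (cls g ∈ insert (cls ℓ₀) 𝒮) ∧ cls f ≠ cls g
        then (Per (Metric.closedBall (0 : EuclideanSpace ℝ (Fin 3)) 1) (G f) + Per (Metric.closedBall (0 : EuclideanSpace ℝ (Fin 3)) 1) (G g) - Per (Metric.closedBall (0 : EuclideanSpace ℝ (Fin 3)) 1) (G f ∪ G g)) / 2 / 2 else 0) := by
    refine Finset.sum_congr rfl fun f _ => Finset.sum_congr rfl fun g _ => ?_
    simp only [hmem]; rfl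
  rw [hI, hA] at h; rw [← hY]
  exact h

/-- **Deletion row at class level.**  See the module docstring. -/
theorem del_row_classes :
    let Λ : Set (EuclideanSpace ℝ (Fin 3)) := Literature.MathematicalPhysics.StatisticalMechanics.fccStacking 1 (Real.sqrt (2 / 3));
    let Brl : (ℤ → ℤ) → Set (EuclideanSpace ℝ (Fin 3)) := Literature.MathematicalPhysics.StatisticalMechanics.barlowStacking 1 (Real.sqrt (2 / 3));
    let Ax : EuclideanSpace ℝ (Fin 3) → (EuclideanSpace ℝ (Fin 3) ≃ₗᵢ[ℝ] EuclideanSpace ℝ (Fin 3)) → (EuclideanSpace ℝ (Fin 3) ≃ₗᵢ[ℝ] EuclideanSpace ℝ (Fin 3)) → Prop := fun m A B => ∃ (L : EuclideanSpace ℝ (Fin 3) ≃ₗᵢ[ℝ] EuclideanSpace ℝ (Fin 3)) (s₁ s₂ : EuclideanSpace ℝ (Fin 3)) (σ σ' : ℤ → ℤ), Literature.MathematicalPhysics.StatisticalMechanics.IsHaggSeq σ ∧ Literature.MathematicalPhysics.StatisticalMechanics.IsHaggSeq σ' ∧ L (EuclideanSpace.single (2 : Fin 3) (1 : ℝ)) =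 m ∧ A '' Λ ⊆ (fun q => L q + s₁) '' Brl σ ∧ B '' Λ ⊆ (fun q => L q + s₂) '' Brl σ';
    let CoAx : (EuclideanSpace ℝ (Fin 3) ≃ₗᵢ[ℝ] EuclideanSpace ℝ (Fin 3)) → (EuclideanSpace ℝ (Fin 3) ≃ₗᵢ[ℝ] EuclideanSpace ℝ (Fin 3)) → Prop := fun A B => ∃ m, Ax m A B;
    let Φ : EuclideanSpace ℝ (Fin 3) → ℝ := fun ν => Real.sqrt 2 / 4 * ∑ᶠ w ∈ {w ∈ Λ | ‖w‖ = 1}, |⟪w, ν⟫_ℝ|;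
    let Per : Set (EuclideanSpace ℝ (Fin 3)) → Set (EuclideanSpace ℝ (Fin 3)) → ℝ := fun K S => (⨆ (ξ : EuclideanSpace ℝ (Fin 3) → EuclideanSpace ℝ (Fin 3)) (_ : ContDiff ℝ 1 ξ ∧ HasCompactSupport ξ ∧ ∀ z, ξ z ∈ K), ENNReal.ofReal (∫ z in S, Literature.MathematicalPhysics.StatisticalMechanics.fieldDivergence ξ z)).toReal;
    let ι : Set (EuclideanSpace ℝ (Fin 3)) → Set (EuclideanSpace ℝ (Fin 3)) → Set (EuclideanSpace ℝ (Fin 3)) → ℝ := fun K S₁ S₂ => (Per K S₁ + Per K S₂ - Per K (S₁ ∪ S₂)) / 2;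
    let W : (EuclideanSpace ℝ (Fin 3) ≃ₗᵢ[ℝ] EuclideanSpace ℝ (Fin 3)) → Set (EuclideanSpace ℝ (Fin 3)) := fun A => {y | ∀ ν : EuclideanSpace ℝ (Fin 3), ⟪y, ν⟫_ℝ ≤ Φ (A.symm ν)};
    let Dsc : EuclideanSpace ℝ (Fin 3) → Set (EuclideanSpace ℝ (Fin 3)) := fun m => {y | ‖y‖ ≤ 1 ∧ ⟪y, m⟫_ℝ = 0};
    let Tex : (n : ℕ) → (Fin n → Set (EuclideanSpace ℝ (Fin 3))) → (Fin n → (EuclideanSpace ℝ (Fin 3) ≃ₗᵢ[ℝ] EuclideanSpace ℝ (Fin 3))) → (Fin n → Fin n → ℝ) → (Fin n → Fin n → EuclideanSpace ℝ (Fin 3)) → Prop := fun n G A c m => (∀ f : Fin n, Literature.MathematicalPhysics.StatisticalMechanics.HasFinitePerimeter (G f) ∧ volume (G f) < ⊤) ∧ (∀ f g, f ≠ g → Disjoint (G f) (G g)) ∧ (∀ f g, f ≠ g → 0 ≤ c f g) ∧ (∀ f g, f ≠ g → ¬ CoAx (A f) (A g) → m f g = 0 ∧ 1 ≤ c f g)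 ∧ (∀ f g, f ≠ g → CoAx (A f) (A g) → A f '' Λ ≠ A g '' Λ → Ax (m f g) (A f) (A g) ∧ 1 / 2 ≤ c f g);
    let En : (n : ℕ) → (Fin n → Set (EuclideanSpace ℝ (Fin 3))) → (Fin n → (EuclideanSpace ℝ (Fin 3) ≃ₗᵢ[ℝ] EuclideanSpace ℝ (Fin 3))) → (Fin n → Fin n → ℝ) → (Fin n → Fin n → EuclideanSpace ℝ (Fin 3)) → ℝ := fun n G A c m => ∑ f : Fin n, Per (W (A f)) (G f) - ∑ f, ∑ g, (if f = g then 0 else ι (W (A f)) (G f) (G g)) + ∑ f, ∑ g, (if f = g then 0 else c f g / 2 * ι (Dsc (m f g)) (G f) (G g));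
    let Vol : (n : ℕ) → (Fin n → Set (EuclideanSpace ℝ (Fin 3))) → ℝ := fun n G => (volume (⋃ f : Fin n, G f)).toReal;
    let Poly : Set (EuclideanSpace ℝ (Fin 3)) → Prop := fun S => ∃ (k : ℕ) (H : Fin k → Finset ((EuclideanSpace ℝ (Fin 3)) × ℝ)), S = ⋃ i, ⋂ p ∈ H i, {x | ⟪p.1, x⟫_ℝ < p.2};
    let TF : (n : ℕ) → (Fin n → (EuclideanSpace ℝ (Fin 3) ≃ₗᵢ[ℝ] EuclideanSpace ℝ (Fin 3))) → Prop := fun n A => ∀ f g : Fin n, f ≠ g → CoAx (A f) (A g) → A f '' Λ = A g '' Λ;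
    ∀ (n : ℕ) (G : Fin n → Set (EuclideanSpace ℝ (Fin 3))) (A : Fin n → (EuclideanSpace ℝ (Fin 3) ≃ₗᵢ[ℝ] EuclideanSpace ℝ (Fin 3))) (c : Fin n → Fin n → ℝ) (m : Fin n → Fin n → EuclideanSpace ℝ (Fin 3))
      (β : Type) [Fintype β] [DecidableEq β] (cls : Fin n → β) (𝒮 : Finset β) (g₀ : Fin n),
      Tex n G A c m → (∀ f, Poly (G f)) → TF n A →
      (∀ f g : Fin n, cls f = cls g ↔ A f '' Λ = A g '' Λ) → cls g₀ ∉ 𝒮 → (∃ f, cls f ∈ 𝒮) →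
      (∀ (G' : Fin n → Set (EuclideanSpace ℝ (Fin 3))) (A' : Fin n → (EuclideanSpace ℝ (Fin 3) ≃ₗᵢ[ℝ] EuclideanSpace ℝ (Fin 3)))
        (c' : Fin n → Fin n → ℝ) (m' : Fin n → Fin n → EuclideanSpace ℝ (Fin 3)),
        Tex n G' A' c' m' → (∀ f, Poly (G' f)) → TF n A' →
        (Finset.univ.image fun f => A' f '' Λ).card < (Finset.univ.image fun f => A f '' Λ).card →
        6 * (2 : ℝ) ^ ((1 : ℝ) / 3) * (Real.sqrt 2 * Vol n G') ^ ((2 : ℝ) / 3) ≤ En n G' A' c' m') →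
      6 * (2 : ℝ) ^ ((1 : ℝ) / 3) * (Real.sqrt 2 * (Vol n G
          - ∑ i ∈ 𝒮, (volume (⋃ f ∈ Finset.univ.filter (fun f => cls f = i), G f)).toReal)) ^ ((2 : ℝ) / 3) ≤ En n G A c m
        - (∑ i ∈ 𝒮, (∑ f ∈ Finset.univ.filter (fun f => cls f = i), (Per (W (A f)) (G f) - ∑ g, (if f = g then 0 else ι (W (A f)) (G f) (G g)))))
        + (Real.sqrt 5 - 1) * (∑ i ∈ Finset.univ \ 𝒮, ∑ j ∈ 𝒮, (∑ f ∈ Finset.univ.filter (fun f => cls f = i), ∑ g ∈ Finset.univ.filter (fun g => cls g = j), (Per (Metric.closedBall (0 : EuclideanSpace ℝ (Fin 3)) 1) (G f) + Per (Metric.closedBall (0 : EuclideanSpace ℝ (Fin 3)) 1) (G g) - Per (Metric.closedBall (0 : EuclideanSpace ℝ (Fin 3)) 1) (G f ∪ G g)) / 2))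
        - (∑ i, ∑ j, (if ((i ∈ 𝒮) ∧ (j ∈ 𝒮)) ∧ i ≠ j then (∑ f ∈ Finset.univ.filter (fun f => cls f = i), ∑ g ∈ Finset.univ.filter (fun g => cls g = j), (Per (Metric.closedBall (0 : EuclideanSpace ℝ (Fin 3)) 1) (G f) + Per (Metric.closedBall (0 : EuclideanSpace ℝ (Fin 3)) 1) (G g) - Per (Metric.closedBall (0 : EuclideanSpace ℝ (Fin 3)) 1) (G f ∪ G g)) / 2) / 2 else 0)) := by
  intro Λ Brl Ax CoAx Φ Per ι W Dsc Tex En Vol Poly TF n G A c m β _ _ cls 𝒮 g₀ hTex hPoly hTF hcls hg₀ hne hIH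
  classical
  set S : Finset (Fin n) := Finset.univ.filter (fun f => cls f ∈ 𝒮) with hSdef
  have hS : ∀ f g : Fin n, cls f = cls g → f ∈ S → g ∈ S := by
    intro f g hfg hf; simp only [hSdef, Finset.mem_filter, Finset.mem_univ, true_and] at hf ⊢; rwa [← hfg]
  have hg₀S : g₀ ∉ S := by simp only [hSdef, Finset.mem_filter, Finset.mem_univ, true_and]; exact hg₀
  have hneS : S.Nonempty := by
    obtain ⟨f, hf⟩ := hne; exact ⟨f, Finset.mem_filter.2 ⟨Finset.mem_univ _, hf⟩⟩
  have h := del_row_of_IH n G A c m β cls S g₀ hTex hPoly hTF hcls hS hg₀S hneS hIH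
  obtain ⟨hfin, hdisj, -, -, -⟩ := hTex
  have hvolS : (∑ f ∈ S, (volume (G f)).toReal) =
      ∑ i ∈ 𝒮, (volume (⋃ f ∈ Finset.univ.filter (fun f => cls f = i), G f)).toReal := by
    rw [classSet_sum cls (fun f => (volume (G f)).toReal) 𝒮]
    refine Finset.sum_congr rfl fun i _ => ?_
    exact ((subfamily_union_facts G hfin hdisj _).2.2.2).symm
  have hF := classSet_sum cls (fun f => Per (W (A f)) (G f) - ∑ g, (if f = g then 0 else ι (W (A f)) (G f) (G g))) 𝒮
  have hX := classSet_cut_sum cls (fun f g => ι (Metric.closedBall (0 : EuclideanSpace ℝ (Fin 3)) 1) (G f) (G g)) 𝒮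
  have hA := classCross_sum cls (fun f g => (Per (Metric.closedBall (0 : EuclideanSpace ℝ (Fin 3)) 1) (G f) + Per (Metric.closedBall (0 : EuclideanSpace ℝ (Fin 3)) 1) (G g) - Per (Metric.closedBall (0 : EuclideanSpace ℝ (Fin 3)) 1) (G f ∪ G g)) / 2) (fun i => i ∈ 𝒮)
  have hI : (∑ f, ∑ g, (if f ≠ g ∧ f ∈ S ∧ g ∈ S ∧ cls f ≠ cls g then ι (Metric.closedBall (0 : EuclideanSpace ℝ (Fin 3)) 1) (G f) (G g) / 2 else 0)) =
      ∑ f, ∑ g, (if f ≠ g ∧ (cls f ∈ 𝒮) ∧ (cls g ∈ 𝒮) ∧ cls f ≠ cls g then (Per (Metric.closedBall (0 : EuclideanSpace ℝ (Fin 3)) 1) (G f) + Per (Metric.closedBall (0 : EuclideanSpace ℝ (Fin 3)) 1) (G g) - Per (Metric.closedBall (0 : EuclideanSpace ℝ (Fin 3)) 1) (G f ∪ G g)) / 2 / 2 else 0) := by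
    refine Finset.sum_congr rfl fun f _ => Finset.sum_congr rfl fun g _ => ?_
    simp only [hSdef, Finset.mem_filter, Finset.mem_univ, true_and]; rfl
  have hXe : (∑ f, ∑ g, (if f ∉ S ∧ g ∈ S then ι (Metric.closedBall (0 : EuclideanSpace ℝ (Fin 3)) 1) (G f) (G g) else 0)) =
      ∑ i ∈ Finset.univ \ 𝒮, ∑ j ∈ 𝒮, (∑ f ∈ Finset.univ.filter (fun f => cls f = i), ∑ g ∈ Finset.univ.filter (fun g => cls g = j), (Per (Metric.closedBall (0 : EuclideanSpace ℝ (Fin 3)) 1) (G f) + Per (Metric.closedBall (0 : EuclideanSpace ℝ (Fin 3)) 1) (G g) - Per (Metric.closedBall (0 : EuclideanSpace ℝ (Fin 3)) 1) (G f ∪ G g)) / 2) := by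
    rw [hX]
  rw [hvolS, hF, hXe, hI, hA] at h
  exact h

end Summit.Ventures.Crystal3D.Cruxes.PolycrystalWulffBound.PolyDensity

end
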